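import Summits.CriticalPhenomena.CardyFormulaZ2.Theorems.CardyBoundaryCoulombGasRectilinearCardyStubRowBlocksPart8
import Summits.CriticalPhenomena.CardyFormulaZ2.Theorems.CardyBoundaryCoulombGasRectilinearCardyStubRowBlocksPart9
import HarnessLib

/-!
# Stub B `stub_rowBlocks` of line `excursion-kernel-covariance`, part 10: the two blocks along the
# boundary cycle
# (crux `RectilinearCardy`, stmt-CriticalPhenomena-5660, route `CardyBoundaryCoulombGas`)

The core of the ROW BLOCKS stub in the language of the reversed (positively oriented) Jordan domain
`D` of the conformal rectangle `R`: given the boundary cycle `e` of the closure lattice polygon with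
normalised lifted feet `F` (the BOUNDARY FEET stub), the four flat zones (window foot `∂D(tv)`, marks
`b = ∂D(tb)`, `a = ∂D(ta)`, `d = ∂D(td)` with `tX < tv < tb < ta < td < tX + 1`) with their frames,
lattice frames, tangential signs and arc descriptions, and the scales of parts 7–8,
`rb_main_blocks` produces the three anchor indices `ib < ia < id` (row darts within `2δ` of `b, a, d`,
feet within `ε₂` of `tb, ta, td`) and the two BLOCK CHARACTERISATIONS: a row dart `e i` is attributed
to the arc `∂D([tb, ta])` (= `R.arc 0`) iff `ib ≤ i ≤ ia`, and to the tail arc `∂D([td - 1, tv])` iff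
`i ≤ 1 ∨ id ≤ i` (zone results `rb_zone_mark_result` ×3, `rb_zone_window_result`, and the combinatorial
block lemmas `rb_block_arc`, `rb_block_tail` fed by `rb_near_arc_of_attr`, `rb_foot_window`,
`rb_attr_of_mid`).

All [folklore].
-/

noncomputable section

open Set Metric
open Literature.Probability.RandomPlanarGeometry
open Literature.Probability.LatticeModels (Site meshPoint Orient)
open Literature.Probability.LatticeModels.CollarLegModel (Dart dartTip dir dsucc outDart period neighbours)

namespace Summit.CriticalPhenomena.CardyFormulaZ2.Cruxes.RectilinearCardy.ExcursionKernelCovariance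

/-- The foot of a mark's anchor dart is far from both ends of the period. [folklore] -/
theorem rb_foot_range_of_gap {F : ℕ → ℝ} {ib : ℕ} {tX tb ta td θ' ε₂ : ℝ} (hε : ε₂ ≤ θ')
    (hgap : tX + 5 * θ' ≤ tb ∧ tb + 5 * θ' ≤ ta ∧ ta + 5 * θ' ≤ td ∧ td + 5 * θ' ≤ tX + 1) (hF : |F ib - tb| < ε₂) :
    tX + 4 * θ' ≤ F ib ∧ F ib ≤ tX + 1 - 4 * θ' := by
  rw [abs_lt] at hF; constructor <;> linarith

/-- **The two blocks along the boundary cycle.** See the module docstring. [folklore] -/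
theorem rb_main_blocks (R : ConformalRectangle) (D : JordanDomain) (hDc : D.carrier = R.carrier)
    {δ η r rz ε₂ m₂ θ θ' tX tv tb ta td Hw Hb Ha Hd sTw sTb sTa sTd : ℝ} {V : Finset (ℤ × ℤ)} {e : ℕ → Dart} {F : ℕ → ℝ} {P N : ℕ}
    {ow ob oa od : Orient} {kw kb ka kd : Fin 4} {sw sb sa sd : ℤ} {X : ℤ × ℤ}
    (hδ : 0 < δ) (hη : 0 < η) (hV : ∀ x : ℤ × ℤ, x ∈ V ↔ meshPoint δ (![x.1, x.2] : Site 2) ∈ closure D.carrier)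
    (hP : 0 < P) (hsucc : ∀ n, e (n + 1) = dsucc V (e n)) (hper : ∀ n, e (n + P) = e n) (hext : ∀ n, (e n).1 ∈ V ∧ dartTip (e n) ∉ V)
    (henum : ∀ d : Dart, d.1 ∈ V → dartTip d ∉ V → ∃ n, n < P ∧ e n = d) (hnodup : ∀ n m, n < P → m < P → e n = e m → n = m)
    (hFmono : ∀ n, F n ≤ F (n + 1)) (hFP : ∀ n, F (n + P) = F n + 1)
    (hFclose : ∀ n, dist (D.boundary (F n)) (meshPoint δ (![(e n).1.1, (e n).1.2] : Site 2)) ≤ η)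
    (hF0 : |F 0 - tX| < ε₂) (htv : tX ≤ tv ∧ tv ≤ tX + ε₂)
    (hcw : Orient.nrmC ow (D.boundary tv) = Hw) (hclw : ∀ z, dist z (D.boundary tv) < r → (z ∈ closure D.carrier ↔ Hw ≤ Orient.nrmC ow z))
    (hopw : ∀ z, dist z (D.boundary tv) < r → (z ∈ D.carrier ↔ Hw < Orient.nrmC ow z))
    (hcb : Orient.nrmC ob (D.boundary tb) = Hb) (hclb : ∀ z, dist z (D.boundary tb) < r → (z ∈ closure D.carrier ↔ Hb ≤ Orient.nrmC ob z))
    (hopb : ∀ z, dist z (D.boundary tb) < r → (z ∈ D.carrier ↔ Hb < Orient.nrmC ob z))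
    (hca : Orient.nrmC oa (D.boundary ta) = Ha) (hcla : ∀ z, dist z (D.boundary ta) < r → (z ∈ closure D.carrier ↔ Ha ≤ Orient.nrmC oa z))
    (hopa : ∀ z, dist z (D.boundary ta) < r → (z ∈ D.carrier ↔ Ha < Orient.nrmC oa z))
    (hcd : Orient.nrmC od (D.boundary td) = Hd) (hcld : ∀ z, dist z (D.boundary td) < r → (z ∈ closure D.carrier ↔ Hd ≤ Orient.nrmC od z))
    (hopd : ∀ z, dist z (D.boundary td) < r → (z ∈ D.carrier ↔ Hd < Orient.nrmC od z))
    (htabw : ∀ x : ℤ × ℤ, Orient.nrm ow (![(x + dir kw).1, (x + dir kw).2] : Site 2) = Orient.nrm ow (![x.1, x.2] : Site 2) - 1 ∧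
      Orient.nrm ow (![(x + dir (kw + 1)).1, (x + dir (kw + 1)).2] : Site 2) = Orient.nrm ow (![x.1, x.2] : Site 2) ∧
      Orient.nrm ow (![(x + dir (kw + 2)).1, (x + dir (kw + 2)).2] : Site 2) = Orient.nrm ow (![x.1, x.2] : Site 2) + 1 ∧
      Orient.nrm ow (![(x + dir (kw + 3)).1, (x + dir (kw + 3)).2] : Site 2) = Orient.nrm ow (![x.1, x.2] : Site 2) ∧
      Orient.tng ow (![(x + dir (kw + 1)).1, (x + dir (kw + 1)).2] : Site 2) = Orient.tng ow (![x.1, x.2] : Site 2) + sw ∧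
      Orient.tng ow (![(x + dir (kw + 3)).1, (x + dir (kw + 3)).2] : Site 2) = Orient.tng ow (![x.1, x.2] : Site 2) - sw)
    (hk₀w : ∀ (x : ℤ × ℤ) (k : Fin 4), Orient.nrm ow (![x.1, x.2] : Site 2) - 1 ≤ Orient.nrm ow (![(x + dir k).1, (x + dir k).2] : Site 2) ∧
      (Orient.nrm ow (![(x + dir k).1, (x + dir k).2] : Site 2) = Orient.nrm ow (![x.1, x.2] : Site 2) - 1 ↔ k = kw))
    (htabb : ∀ x : ℤ × ℤ, Orient.nrm ob (![(x + dir kb).1, (x + dir kb).2] : Site 2) = Orient.nrm ob (![x.1, x.2] : Site 2) - 1 ∧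
      Orient.nrm ob (![(x + dir (kb + 1)).1, (x + dir (kb + 1)).2] : Site 2) = Orient.nrm ob (![x.1, x.2] : Site 2) ∧
      Orient.nrm ob (![(x + dir (kb + 2)).1, (x + dir (kb + 2)).2] : Site 2) = Orient.nrm ob (![x.1, x.2] : Site 2) + 1 ∧
      Orient.nrm ob (![(x + dir (kb + 3)).1, (x + dir (kb + 3)).2] : Site 2) = Orient.nrm ob (![x.1, x.2] : Site 2) ∧
      Orient.tng ob (![(x + dir (kb + 1)).1, (x + dir (kb + 1)).2] : Site 2) = Orient.tng ob (![x.1, x.2] : Site 2) + sb ∧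
      Orient.tng ob (![(x + dir (kb + 3)).1, (x + dir (kb + 3)).2] : Site 2) = Orient.tng ob (![x.1, x.2] : Site 2) - sb)
    (hk₀b : ∀ (x : ℤ × ℤ) (k : Fin 4), Orient.nrm ob (![x.1, x.2] : Site 2) - 1 ≤ Orient.nrm ob (![(x + dir k).1, (x + dir k).2] : Site 2) ∧
      (Orient.nrm ob (![(x + dir k).1, (x + dir k).2] : Site 2) = Orient.nrm ob (![x.1, x.2] : Site 2) - 1 ↔ k = kb))
    (htaba : ∀ x : ℤ × ℤ, Orient.nrm oa (![(x + dir ka).1, (x + dir ka).2] : Site 2) = Orient.nrm oa (![x.1, x.2] : Site 2) - 1 ∧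
      Orient.nrm oa (![(x + dir (ka + 1)).1, (x + dir (ka + 1)).2] : Site 2) = Orient.nrm oa (![x.1, x.2] : Site 2) ∧
      Orient.nrm oa (![(x + dir (ka + 2)).1, (x + dir (ka + 2)).2] : Site 2) = Orient.nrm oa (![x.1, x.2] : Site 2) + 1 ∧
      Orient.nrm oa (![(x + dir (ka + 3)).1, (x + dir (ka + 3)).2] : Site 2) = Orient.nrm oa (![x.1, x.2] : Site 2) ∧
      Orient.tng oa (![(x + dir (ka + 1)).1, (x + dir (ka + 1)).2] : Site 2) = Orient.tng oa (![x.1, x.2] : Site 2) + sa ∧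
      Orient.tng oa (![(x + dir (ka + 3)).1, (x + dir (ka + 3)).2] : Site 2) = Orient.tng oa (![x.1, x.2] : Site 2) - sa)
    (hk₀a : ∀ (x : ℤ × ℤ) (k : Fin 4), Orient.nrm oa (![x.1, x.2] : Site 2) - 1 ≤ Orient.nrm oa (![(x + dir k).1, (x + dir k).2] : Site 2) ∧
      (Orient.nrm oa (![(x + dir k).1, (x + dir k).2] : Site 2) = Orient.nrm oa (![x.1, x.2] : Site 2) - 1 ↔ k = ka))
    (htabd : ∀ x : ℤ × ℤ, Orient.nrm od (![(x + dir kd).1, (x + dir kd).2] : Site 2) = Orient.nrm od (![x.1, x.2] : Site 2) - 1 ∧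
      Orient.nrm od (![(x + dir (kd + 1)).1, (x + dir (kd + 1)).2] : Site 2) = Orient.nrm od (![x.1, x.2] : Site 2) ∧
      Orient.nrm od (![(x + dir (kd + 2)).1, (x + dir (kd + 2)).2] : Site 2) = Orient.nrm od (![x.1, x.2] : Site 2) + 1 ∧
      Orient.nrm od (![(x + dir (kd + 3)).1, (x + dir (kd + 3)).2] : Site 2) = Orient.nrm od (![x.1, x.2] : Site 2) ∧
      Orient.tng od (![(x + dir (kd + 1)).1, (x + dir (kd + 1)).2] : Site 2) = Orient.tng od (![x.1, x.2] : Site 2) + sd ∧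
      Orient.tng od (![(x + dir (kd + 3)).1, (x + dir (kd + 3)).2] : Site 2) = Orient.tng od (![x.1, x.2] : Site 2) - sd)
    (hk₀d : ∀ (x : ℤ × ℤ) (k : Fin 4), Orient.nrm od (![x.1, x.2] : Site 2) - 1 ≤ Orient.nrm od (![(x + dir k).1, (x + dir k).2] : Site 2) ∧
      (Orient.nrm od (![(x + dir k).1, (x + dir k).2] : Site 2) = Orient.nrm od (![x.1, x.2] : Site 2) - 1 ↔ k = kd))
    (hsw : sw = 1 ∨ sw = -1) (hsb : sb = 1 ∨ sb = -1) (hsa : sa = 1 ∨ sa = -1) (hsd : sd = 1 ∨ sd = -1)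
    (hsTw : sTw = 1 ∨ sTw = -1) (hsTb : sTb = 1 ∨ sTb = -1) (hsTa : sTa = 1 ∨ sTa = -1) (hsTd : sTd = 1 ∨ sTd = -1)
    (hTw : ∀ t t' : ℝ, |t - tv| ≤ 2 * θ → |t' - tv| ≤ 2 * θ → t < t' → 0 < sTw * (Orient.tngC ow (D.boundary t') - Orient.tngC ow (D.boundary t)))
    (hTb : ∀ t t' : ℝ, |t - tb| ≤ 2 * θ → |t' - tb| ≤ 2 * θ → t < t' → 0 < sTb * (Orient.tngC ob (D.boundary t') - Orient.tngC ob (D.boundary t)))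
    (hTa : ∀ t t' : ℝ, |t - ta| ≤ 2 * θ → |t' - ta| ≤ 2 * θ → t < t' → 0 < sTa * (Orient.tngC oa (D.boundary t') - Orient.tngC oa (D.boundary t)))
    (hTd : ∀ t t' : ℝ, |t - td| ≤ 2 * θ → |t' - td| ≤ 2 * θ → t < t' → 0 < sTd * (Orient.tngC od (D.boundary t') - Orient.tngC od (D.boundary t)))
    (hθ : 4 * ε₂ ≤ θ' ∧ θ' ≤ θ) (hunif : ∀ s t : ℝ, |s - t| ≤ 3 * θ' → dist (D.boundary s) (D.boundary t) < r / 16)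
    (htube : ∀ s t : ℝ, (∀ n : ℤ, ε₂ ≤ |s - t - n|) → m₂ ≤ dist (D.boundary s) (D.boundary t))
    (hrz : rz + η < m₂) (hN1 : 3 * η ≤ N * δ) (hN2 : (N + 4) * δ ≤ rz) (hrzr : rz ≤ r / 8) (hrδ : 40 * δ ≤ r)
    (hgap : tX + 5 * θ' ≤ tb ∧ tb + 5 * θ' ≤ ta ∧ ta + 5 * θ' ≤ td ∧ td + 5 * θ' ≤ tX + 1)
    (h0 : e 0 = (X, kw)) (hXn : Orient.nrm ow (![X.1, X.2] : Site 2) = ⌈Hw / δ⌉) (hXdist : dist (meshPoint δ (![X.1, X.2] : Site 2)) (D.boundary tv) < 2 * δ)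
    (hXt : Orient.tngC ow (D.boundary tv) = δ * ((Orient.tng ow (![X.1, X.2] : Site 2) + sw : ℤ) : ℝ))
    (hfarb : r / 2 ≤ dist (meshPoint δ (![X.1, X.2] : Site 2)) (D.boundary tb)) (hfara : r / 2 ≤ dist (meshPoint δ (![X.1, X.2] : Site 2)) (D.boundary ta))
    (hfard : r / 2 ≤ dist (meshPoint δ (![X.1, X.2] : Site 2)) (D.boundary td))
    (hsepw : r ≤ dist (D.boundary tb) (D.boundary tv)) (hsepad : r ≤ dist (D.boundary ta) (D.boundary td))
    (hAb : ∀ z ∈ frontier D.carrier, dist z (D.boundary tb) < r →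
      (z ∈ D.boundary '' Icc tb ta ↔ 0 ≤ ((1 : ℤ) : ℝ) * sTb * (Orient.tngC ob z - Orient.tngC ob (D.boundary tb))))
    (hAa : ∀ z ∈ frontier D.carrier, dist z (D.boundary ta) < r →
      (z ∈ D.boundary '' Icc tb ta ↔ 0 ≤ ((-1 : ℤ) : ℝ) * sTa * (Orient.tngC oa z - Orient.tngC oa (D.boundary ta))))
    (hAd : ∀ z ∈ frontier D.carrier, dist z (D.boundary td) < r →
      (z ∈ D.boundary '' Icc (td - 1) tv ↔ 0 ≤ ((1 : ℤ) : ℝ) * sTd * (Orient.tngC od z - Orient.tngC od (D.boundary td))))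
    (hAw : ∀ z ∈ frontier D.carrier, dist z (D.boundary tv) < r →
      (z ∈ D.boundary '' Icc (td - 1) tv ↔ 0 ≤ -sTw * (Orient.tngC ow z - Orient.tngC ow (D.boundary tv))))
    (hCne₁ : (frontier D.carrier \ D.boundary '' Icc tb ta).Nonempty) (hCne₂ : (frontier D.carrier \ D.boundary '' Icc (td - 1) tv).Nonempty) :
    ∃ ib ia id : ℕ, 3 < ib ∧ ib < ia ∧ ia + 1 < id ∧ id + 3 < P ∧
      |F ib - tb| < ε₂ ∧ |F ia - ta| < ε₂ ∧ |F id - td| < ε₂ ∧ (e ib).2 = kb ∧ (e ia).2 = ka ∧ (e id).2 = kd ∧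
      Orient.nrm ob (![(e ib).1.1, (e ib).1.2] : Site 2) = ⌈Hb / δ⌉ ∧ Orient.nrm oa (![(e ia).1.1, (e ia).1.2] : Site 2) = ⌈Ha / δ⌉ ∧
      Orient.nrm od (![(e id).1.1, (e id).1.2] : Site 2) = ⌈Hd / δ⌉ ∧
      dist (meshPoint δ (![(e ib).1.1, (e ib).1.2] : Site 2)) (D.boundary tb) < 2 * δ ∧
      dist (meshPoint δ (![(e ia).1.1, (e ia).1.2] : Site 2)) (D.boundary ta) < 2 * δ ∧
      dist (meshPoint δ (![(e id).1.1, (e id).1.2] : Site 2)) (D.boundary td) < 2 * δ ∧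
      ((neighbours (e 0).1).filter (fun y ↦ y ∉ V)).card = 1 ∧ ((neighbours (e 1).1).filter (fun y ↦ y ∉ V)).card = 1 ∧
      ((neighbours (e ib).1).filter (fun y ↦ y ∉ V)).card = 1 ∧ ((neighbours (e ia).1).filter (fun y ↦ y ∉ V)).card = 1 ∧
      ((neighbours (e id).1).filter (fun y ↦ y ∉ V)).card = 1 ∧
      e 1 = (X + dir (kw + 1), kw) ∧ e (P - 1) = (X + dir (kw + 3), kw) ∧
      (∀ i < P, (((neighbours (e i).1).filter (fun y ↦ y ∉ V)).card = 1 ∧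
          infDist (meshPoint δ (![(e i).1.1, (e i).1.2] : Site 2)) (D.boundary '' Icc tb ta) ≤
            infDist (meshPoint δ (![(e i).1.1, (e i).1.2] : Site 2)) (frontier D.carrier \ D.boundary '' Icc tb ta)) ↔
        ib ≤ i ∧ i ≤ ia ∧ ((neighbours (e i).1).filter (fun y ↦ y ∉ V)).card = 1) ∧
      (∀ i < P, (((neighbours (e i).1).filter (fun y ↦ y ∉ V)).card = 1 ∧
          infDist (meshPoint δ (![(e i).1.1, (e i).1.2] : Site 2)) (D.boundary '' Icc (td - 1) tv) ≤
            infDist (meshPoint δ (![(e i).1.1, (e i).1.2] : Site 2)) (frontier D.carrier \ D.boundary '' Icc (td - 1) tv)) ↔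
        (i ≤ 1 ∨ id ≤ i) ∧ ((neighbours (e i).1).filter (fun y ↦ y ∉ V)).card = 1) := by
  have hε₂ : 0 < ε₂ := lt_of_le_of_lt (abs_nonneg _) hF0
  have hθ1 : ε₂ ≤ θ' ∧ θ' ≤ θ := ⟨by linarith, hθ.2⟩
  have hmono : Monotone F := monotone_nat_of_le_succ hFmono
  have hVR : ∀ x : ℤ × ℤ, x ∈ V ↔ meshPoint δ (![x.1, x.2] : Site 2) ∈ closure R.carrier := by rw [← hDc]; exact hV
  have hfrR : frontier R.carrier = frontier D.carrier := by rw [hDc]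
  have hunif2 : ∀ s t : ℝ, |s - t| ≤ 2 * θ' → dist (D.boundary s) (D.boundary t) < r / 16 :=
    fun s t h => hunif s t (by linarith [abs_nonneg (s - t)])
  have hfar0 : ∀ c : ℂ, r / 2 ≤ dist (meshPoint δ (![X.1, X.2] : Site 2)) c →
      r / 2 ≤ dist (meshPoint δ (![(e 0).1.1, (e 0).1.2] : Site 2)) c := fun c hc => by rw [h0]; exact hc
  have hA₁f : D.boundary '' Icc tb ta ⊆ frontier D.carrier := by
    rintro _ ⟨t, -, rfl⟩; exact D.boundary_mem_frontier t
  have hA₂f : D.boundary '' Icc (td - 1) tv ⊆ frontier D.carrier := by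
    rintro _ ⟨t, -, rfl⟩; exact D.boundary_mem_frontier t
  have hA₁ne : (D.boundary '' Icc tb ta).Nonempty := ⟨D.boundary tb, tb, ⟨le_rfl, by linarith⟩, rfl⟩
  have hA₂ne : (D.boundary '' Icc (td - 1) tv).Nonempty := ⟨D.boundary tv, tv, ⟨by linarith, le_rfl⟩, rfl⟩
  -- the three mark zones
  obtain ⟨ib, hib3, hibP, hFib, hdb, hnb, hdistb, hcardb, hdirb, hzb⟩ :=
    rb_zone_mark_result D (σ := 1) hδ hη hV hsucc hper hext henum hnodup hFmono hFP hFclose hF0 ⟨by linarith, by linarith⟩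
      hcb hclb hopb htabb hk₀b hsb (Or.inl rfl) hsTb hrδ (hfar0 _ hfarb) hTb hθ1 hunif2 htube hrz hN1 hN2 hrzr hA₁f hA₁ne hCne₁ hAb
  obtain ⟨ia, hia3, hiaP, hFia, hda, hna, hdista, hcarda, hdira, hza⟩ :=
    rb_zone_mark_result D (σ := -1) hδ hη hV hsucc hper hext henum hnodup hFmono hFP hFclose hF0 ⟨by linarith, by linarith⟩
      hca hcla hopa htaba hk₀a hsa (Or.inr rfl) hsTa hrδ (hfar0 _ hfara) hTa hθ1 hunif2 htube hrz hN1 hN2 hrzr hA₁f hA₁ne hCne₁ hAa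
  obtain ⟨id, hid3, hidP, hFid, hdd, hnd, hdistd, hcardd, hdird, hzd⟩ :=
    rb_zone_mark_result D (σ := 1) hδ hη hV hsucc hper hext henum hnodup hFmono hFP hFclose hF0 ⟨by linarith, by linarith⟩
      hcd hcld hopd htabd hk₀d hsd (Or.inl rfl) hsTd hrδ (hfar0 _ hfard) hTd hθ1 hunif2 htube hrz hN1 hN2 hrzr hA₂f hA₂ne hCne₂ hAd
  -- the window zone, with `e ib` as far dart
  have hFfar : tX + 4 * θ' ≤ F ib ∧ F ib ≤ tX + 1 - 4 * θ' := rb_foot_range_of_gap hθ1.1 hgap hFib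
  have hfarw : r / 2 ≤ dist (meshPoint δ (![(e ib).1.1, (e ib).1.2] : Site 2)) (D.boundary tv) := by
    have := dist_triangle (D.boundary tb) (meshPoint δ (![(e ib).1.1, (e ib).1.2] : Site 2)) (D.boundary tv)
    rw [dist_comm (D.boundary tb) (meshPoint δ _)] at this
    linarith
  obtain ⟨hdirw, hF1, he1, hePm1, h6P, hzw0, hzw1⟩ :=
    rb_zone_window_result D hδ hη hV hP hsucc hper hext hnodup hFmono hFP hFclose hF0 htv hcw hclw hopw htabw hk₀w hsw hsTw hrδ
      h0 hXn hXdist hXt hTw hθ1 hunif htube hrz hN1 hN2 hrzr (by omega) hFfar hfarw hA₂f hA₂ne hCne₂ hAw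
  -- tools: range of a foot near an arc point, from the tube lemma
  have hFtop : ∀ i ≤ P, F i ≤ F 0 + 1 := fun i hi => by
    have := hFP 0; rw [zero_add] at this; rw [← this]; exact hmono hi
  have hrow_of : ∀ i, ((neighbours (e i).1).filter (fun y ↦ y ∉ V)).card = 1 →
      (![(e i).1.1, (e i).1.2] : Site 2) ∈ boundaryRow R δ := fun i hc =>
    (rb_mem_boundaryRow_iff R hδ hVR _).2 ⟨by simpa using (hext i).1, by simpa using hc⟩
  have hηδ : η + δ < m₂ := by
    have : ((N : ℝ) + 4) * δ = N * δ + 4 * δ := by ring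
    linarith
  -- the arc block
  have harc := rb_block_arc (P := P) (iA := ib) (iB := ia) (F := F)
    (InA := fun i => ((neighbours (e i).1).filter (fun y ↦ y ∉ V)).card = 1 ∧
      infDist (meshPoint δ (![(e i).1.1, (e i).1.2] : Site 2)) (D.boundary '' Icc tb ta) ≤
        infDist (meshPoint δ (![(e i).1.1, (e i).1.2] : Site 2)) (frontier D.carrier \ D.boundary '' Icc tb ta))
    (Row := fun i => ((neighbours (e i).1).filter (fun y ↦ y ∉ V)).card = 1) (tb := tb) (ta := ta) (ε := ε₂) (θ := θ')
    hmono hθ1.1 (by linarith) (fun i h => h.1) ?_ ?_ ?_ ?_ hFib hFia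
  rotate_left
  · -- feet of attributed row darts lie over the arc
    rintro i hi ⟨hc, hattr⟩
    rw [← hfrR] at hattr
    obtain ⟨t₁, ht₁, hd⟩ := rb_near_arc_of_attr R D hδ (hrow_of i hc) (by linarith) hattr
    obtain ⟨k, hk⟩ := rb_foot_window D htube (hFclose i) hd hηδ
    have h0 : F 0 ≤ F i := hmono (Nat.zero_le i)
    have h1 := hFtop i hi.le
    rw [abs_lt] at hF0 hk
    have hk3 : k ≤ -1 ∨ k = 0 ∨ 1 ≤ k := by omega
    rcases hk3 with hk' | hk' | hk'
    · have : (k : ℝ) ≤ -1 := by exact_mod_cast hk'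
      exfalso; linarith [ht₁.1, ht₁.2]
    · rw [hk', Int.cast_zero, sub_zero] at hk
      constructor <;> linarith [ht₁.1, ht₁.2]
    · have : (1 : ℝ) ≤ k := by exact_mod_cast hk'
      exfalso; linarith [ht₁.1, ht₁.2]
  · -- row darts with feet over the middle of the arc are attributed to it
    intro i _ hc h1 h2
    have hp : dist (meshPoint δ (![(e i).1.1, (e i).1.2] : Site 2)) (D.boundary (F i)) ≤ η := by
      rw [dist_comm]; exact hFclose i
    refine ⟨hc, rb_attr_of_mid D (θ := θ') (ε := ε₂) (t₁ := F i) (η := η) (m₂ := m₂) (by linarith) hθ1.1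
      ⟨by linarith, by linarith⟩ htube hp (by linarith) hCne₁⟩
  · intro i hi hFi
    obtain ⟨hc, -, -, hiff⟩ := hzb i hi hFi
    refine ⟨hc, ?_⟩
    rw [and_iff_right hc, hiff]
    omega
  · intro i hi hFi
    obtain ⟨hc, -, -, hiff⟩ := hza i hi hFi
    refine ⟨hc, ?_⟩
    rw [and_iff_right hc, hiff]
    omega
  -- the tail block
  have htail := rb_block_tail (P := P) (iC := id) (F := F)
    (InT := fun i => ((neighbours (e i).1).filter (fun y ↦ y ∉ V)).card = 1 ∧
      infDist (meshPoint δ (![(e i).1.1, (e i).1.2] : Site 2)) (D.boundary '' Icc (td - 1) tv) ≤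
        infDist (meshPoint δ (![(e i).1.1, (e i).1.2] : Site 2)) (frontier D.carrier \ D.boundary '' Icc (td - 1) tv))
    (Row := fun i => ((neighbours (e i).1).filter (fun y ↦ y ∉ V)).card = 1) (tX := tX) (tv := tv) (td := td) (ε := 2 * ε₂) (θ := θ')
    hmono (by linarith) ⟨htv.1, by linarith⟩ (fun i h => h.1) (by linarith [abs_nonneg (F 0 - tX)])
    hF1 (by have := hFP 0; rwa [zero_add] at this) ?_ ?_ ?_ ?_ ?_ (by linarith [abs_nonneg (F id - td)])
  rotate_left
  · -- feet of attributed row darts lie over the tail arc (start or end of the period)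
    rintro i hi ⟨hc, hattr⟩
    rw [← hfrR] at hattr
    obtain ⟨t₁, ht₁, hd⟩ := rb_near_arc_of_attr R D hδ (hrow_of i hc) (by linarith) hattr
    obtain ⟨k, hk⟩ := rb_foot_window D htube (hFclose i) hd hηδ
    have h0 : F 0 ≤ F i := hmono (Nat.zero_le i)
    have h1 := hFtop i hi.le
    rw [abs_lt] at hF0 hk
    have hk3 : k ≤ -1 ∨ k = 0 ∨ k = 1 ∨ 2 ≤ k := by omega
    rcases hk3 with hk' | hk' | hk' | hk'
    · have : (k : ℝ) ≤ -1 := by exact_mod_cast hk'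
      exfalso; linarith [ht₁.1, ht₁.2]
    · left; rw [hk', Int.cast_zero, sub_zero] at hk; linarith [ht₁.2]
    · right; rw [hk', Int.cast_one] at hk; linarith [ht₁.1]
    · have : (2 : ℝ) ≤ k := by exact_mod_cast hk'
      exfalso; linarith [ht₁.1, ht₁.2]
  · -- row darts with feet over the middle of the tail arc are attributed to it
    intro i _ hc h1 h2
    have hp : dist (meshPoint δ (![(e i).1.1, (e i).1.2] : Site 2)) (D.boundary (F i - 1)) ≤ η := by
      have := D.periodic_boundary.sub_int_mul_eq 1 (x := F i)
      rw [Int.cast_one, mul_one] at this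
      rw [this, dist_comm]; exact hFclose i
    exact ⟨hc, rb_attr_of_mid D (θ := θ') (ε := ε₂) (t₁ := F i - 1) (η := η) (m₂ := m₂) (by linarith) hθ1.1
      ⟨by linarith, by linarith [htv.1]⟩ htube hp (by linarith) hCne₂⟩
  · intro i hi hFi
    obtain ⟨hc, -, -, hiff⟩ := hzd i hi hFi
    refine ⟨hc, ?_⟩
    rw [and_iff_right hc, hiff]
    omega
  · intro i hi hFi
    obtain ⟨hc, -, -, hiff⟩ := hzw0 i hi hFi
    exact ⟨hc, by rw [and_iff_right hc, hiff]⟩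
  · intro i hi hFi
    obtain ⟨hc, -, -, hattr⟩ := hzw1 i hi hFi
    exact ⟨hc, hc, hattr⟩
  -- order of the anchors
  have hlt_of : ∀ a b, F a < F b → a < b := fun a b h => by
    by_contra hle; exact absurd (hmono (not_lt.1 hle)) (not_le.2 h)
  have hib_ia : ib < ia := hlt_of ib ia (by rw [abs_lt] at hFib hFia; linarith)
  have hia_id : ia < id := hlt_of ia id (by rw [abs_lt] at hFia hFid; linarith)
  have hia_id' : ia + 1 ≠ id := by
    intro heq
    have h1 := rb_dsucc_base_dist hδ V (e ia)
    rw [← hsucc, heq] at h1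
    have h2 := dist_triangle (D.boundary ta) (meshPoint δ (![(e ia).1.1, (e ia).1.2] : Site 2)) (D.boundary td)
    have h3 := dist_triangle (meshPoint δ (![(e ia).1.1, (e ia).1.2] : Site 2))
      (meshPoint δ (![(e id).1.1, (e id).1.2] : Site 2)) (D.boundary td)
    have e1 := dist_comm (D.boundary ta) (meshPoint δ (![(e ia).1.1, (e ia).1.2] : Site 2))
    have e2 := dist_comm (meshPoint δ (![(e ia).1.1, (e ia).1.2] : Site 2)) (meshPoint δ (![(e id).1.1, (e id).1.2] : Site 2))
    linarith
  have hcard0 : ((neighbours (e 0).1).filter (fun y ↦ y ∉ V)).card = 1 := (hzw0 0 hP (by linarith [hε₂])).1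
  have hcard1 : ((neighbours (e 1).1).filter (fun y ↦ y ∉ V)).card = 1 := (hzw0 1 (by omega) (by linarith)).1
  exact ⟨ib, ia, id, hib3, hib_ia, by omega, hidP, hFib, hFia, hFid, hdb, hda, hdd, hnb, hna, hnd, hdistb, hdista, hdistd,
    hcard0, hcard1, hcardb, hcarda, hcardd, he1, hePm1, harc, htail⟩

end Summit.CriticalPhenomena.CardyFormulaZ2.Cruxes.RectilinearCardy.ExcursionKernelCovariance

end
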